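import Summits.Ventures.DiscreteObjects.UnitDistance.FieldPlanesCriterion
import Summits.Ventures.DiscreteObjects.UnitDistance.OddCycles

/-!
# Which multiquadratic planes are bipartite: an `iff` (cell `pub-namedobj`, target (U), seat udg g11)

Framing (verbatim for the cell): lottery ticket; floor = certified bounds/negative ranges.

THEOREM (kernel).  Let `S ⊂ ℕ` be finite with no `d ∈ S` divisible by `4`.  The unit-distance graph of `ℚ(√d : d ∈ S)²` is
BIPARTITE if and only if `S` fits one of the two ramified 2-adic patterns (`SquareClassesAvoidNegOneAndThree S`: all
`d ≡ 1, 5 (mod 8)` or `≡ 2, 10 (mod 16)`, resp. all `d ≡ 1, 5 (mod 8)` or `≡ 6, 14 (mod 16)`) — `colorable_two_plane_iff`.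
"If": the 2-adic criterion (`FieldPlanesCriterion`).  "Only if": otherwise `K_S` contains `√m` for some `m ≡ 3 (mod 4)` —
either some `d ∈ S` is itself `≡ 3 (mod 4)`, or two even generators `d₁ ≡ 2, 10` and `d₂ ≡ 6, 14 (mod 16)` give
`m = (d₁/2)(d₂/2) ≡ 3 (mod 4)` with `√m = √d₁·√d₂/2` — and then the zigzag odd cycle of `OddCycles` lives in `K_S²`.
So `χ(K_S²) = 2` exactly for the ramified patterns and `χ(K_S²) ≥ 3` for every other multiquadratic field.
Quadratic case = Johnson 1987 (+ odd cycles); the multiquadratic `iff` was not found in print (PROVISIONAL).  Nothing here is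
literature.
-/

noncomputable section

namespace Summit.Ventures.DiscreteObjects.UnitDistance

open SimpleGraph IntermediateField
open scoped IntermediateField

/-- Combinatorial heart: if no `d ∈ S` is divisible by `4` and `S` fits neither ramified pattern, then either some `d ∈ S` is
`≡ 3 (mod 4)`, or there are `d₁, d₂ ∈ S` with `d₁ ≡ 2, 10 (mod 16)` and `d₂ ≡ 6, 14 (mod 16)`. -/
theorem exists_three_mod_four_of_not_pattern (S : Finset ℕ) (h4 : ∀ d ∈ S, d % 4 ≠ 0)
    (hS : ¬ SquareClassesAvoidNegOneAndThree S) :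
    (∃ d ∈ S, d % 4 = 3) ∨
      (∃ d₁ ∈ S, ∃ d₂ ∈ S, (d₁ % 16 = 2 ∨ d₁ % 16 = 10) ∧ (d₂ % 16 = 6 ∨ d₂ % 16 = 14)) := by
  by_contra hcon
  push Not at hcon
  obtain ⟨h3, h26⟩ := hcon
  apply hS
  unfold SquareClassesAvoidNegOneAndThree
  -- either no generator is `≡ 6, 14 (mod 16)` (pattern `⟨[2],[5]⟩`) or none is `≡ 2, 10` (pattern `⟨[−2],[5]⟩`)
  by_cases hA : ∃ d₁ ∈ S, d₁ % 16 = 2 ∨ d₁ % 16 = 10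
  · obtain ⟨d₁, hd₁, hd₁'⟩ := hA
    left
    intro d hd
    have := h26 d₁ hd₁ d hd hd₁'
    have h3' := h3 d hd
    have h4' := h4 d hd
    omega
  · push Not at hA
    right
    intro d hd
    have := hA d hd
    have h3' := h3 d hd
    have h4' := h4 d hd
    omega

/-- `√((d₁/2)·(d₂/2)) = √d₁·√d₂/2` for even `d₁, d₂`, and it lies in `K_S`. -/
theorem sqrt_half_mul_half_mem {S : Finset ℕ} {d₁ d₂ : ℕ} (h₁ : d₁ ∈ S) (h₂ : d₂ ∈ S) (he₁ : d₁ % 2 = 0)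
    (he₂ : d₂ % 2 = 0) : Real.sqrt (((d₁ / 2) * (d₂ / 2) : ℕ) : ℝ) ∈ multiSqrtField S := by
  have hd₁ : ((d₁ : ℕ) : ℝ) = 2 * ((d₁ / 2 : ℕ) : ℝ) := by
    have : d₁ = 2 * (d₁ / 2) := by omega
    conv_lhs => rw [this]
    push_cast; ring
  have hd₂ : ((d₂ : ℕ) : ℝ) = 2 * ((d₂ / 2 : ℕ) : ℝ) := by
    have : d₂ = 2 * (d₂ / 2) := by omega
    conv_lhs => rw [this]
    push_cast; ring
  have key : Real.sqrt (((d₁ / 2) * (d₂ / 2) : ℕ) : ℝ) = Real.sqrt d₁ * Real.sqrt d₂ / 2 := by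
    have e : (Real.sqrt d₁ * Real.sqrt d₂ / 2) ^ 2 = (((d₁ / 2) * (d₂ / 2) : ℕ) : ℝ) := by
      rw [div_pow, mul_pow, Real.sq_sqrt (Nat.cast_nonneg _), Real.sq_sqrt (Nat.cast_nonneg _), hd₁, hd₂]
      push_cast; ring
    rw [← e, Real.sqrt_sq (by positivity)]
  rw [key]
  exact div_mem (mul_mem (sqrt_mem_multiSqrtField h₁) (sqrt_mem_multiSqrtField h₂)) (ofNat_mem _ 2)

/-- ONLY IF: if `S` (no `d` divisible by `4`) fits neither ramified pattern, `K_S²` contains an odd unit cycle. -/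
theorem not_colorable_two_plane_of_not_pattern (S : Finset ℕ) (h4 : ∀ d ∈ S, d % 4 ≠ 0)
    (hS : ¬ SquareClassesAvoidNegOneAndThree S) :
    ¬ (planeUnitDistanceGraph.induce (fieldPoints (multiSqrtField S))).Colorable 2 := by
  rcases exists_three_mod_four_of_not_pattern S h4 hS with ⟨d, hd, hd3⟩ | ⟨d₁, hd₁, d₂, hd₂, h₁, h₂⟩
  · exact not_colorable_two_plane_multiSqrtField hd hd3
  · have e1 : (d₁ / 2) % 4 = 1 := by omega
    have e2 : (d₂ / 2) % 4 = 3 := by omega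
    have hm : ((d₁ / 2) * (d₂ / 2)) % 4 = 3 := by rw [Nat.mul_mod, e1, e2]
    exact not_colorable_two_plane_of_sqrt_mem_of_mod_four _ hm _
      (sqrt_half_mul_half_mem hd₁ hd₂ (by omega) (by omega))

/-- THE BIPARTITENESS CRITERION (iff): for `S` with no `d` divisible by `4`, `ℚ(√d : d ∈ S)²` is bipartite iff `S` fits a
ramified 2-adic pattern. -/
theorem colorable_two_plane_iff (S : Finset ℕ) (h4 : ∀ d ∈ S, d % 4 ≠ 0) :
    (planeUnitDistanceGraph.induce (fieldPoints (multiSqrtField S))).Colorable 2 ↔ SquareClassesAvoidNegOneAndThree S := by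
  constructor
  · intro h
    by_contra hS
    exact not_colorable_two_plane_of_not_pattern S h4 hS h
  · exact colorable_two_plane_of_squareClasses S

/-- Equivalently: `χ(K_S²) = 2` iff the ramified pattern holds (else `χ(K_S²) ≥ 3`). -/
theorem chromaticNumber_plane_eq_two_iff (S : Finset ℕ) (h4 : ∀ d ∈ S, d % 4 ≠ 0) :
    (planeUnitDistanceGraph.induce (fieldPoints (multiSqrtField S))).chromaticNumber = 2 ↔
      SquareClassesAvoidNegOneAndThree S := by
  rw [← colorable_two_plane_iff S h4]
  constructor
  · intro h
    rw [show (2 : ℕ∞) = (1 : ℕ) + 1 by norm_num] at h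
    exact (chromaticNumber_eq_iff_colorable_not_colorable.mp h).1
  · intro h
    rw [show (2 : ℕ∞) = (1 : ℕ) + 1 by norm_num]
    exact chromaticNumber_eq_iff_colorable_not_colorable.mpr ⟨h, not_colorable_one_plane _⟩

/-- TRICHOTOMY inside the 2-adic criterion: if the square classes of `S` (no `d` divisible by `4`) avoid `[−1]`, then either `S` is
ramified and `χ(K_S²) = 2`, or `χ(K_S²) ∈ {3, 4}` (stated as: not `2`-colourable and `4`-colourable). -/
theorem squareClass_trichotomy (S : Finset ℕ) (h4 : ∀ d ∈ S, d % 4 ≠ 0) (hS : SquareClassesAvoidNegOne S) :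
    (SquareClassesAvoidNegOneAndThree S ∧
        (planeUnitDistanceGraph.induce (fieldPoints (multiSqrtField S))).chromaticNumber = 2) ∨
      (¬ SquareClassesAvoidNegOneAndThree S ∧
        ¬ (planeUnitDistanceGraph.induce (fieldPoints (multiSqrtField S))).Colorable 2 ∧
        (planeUnitDistanceGraph.induce (fieldPoints (multiSqrtField S))).Colorable 4) := by
  by_cases h : SquareClassesAvoidNegOneAndThree S
  · exact Or.inl ⟨h, chromaticNumber_plane_eq_two S h⟩
  · exact Or.inr ⟨h, not_colorable_two_plane_of_not_pattern S h4 h, colorable_four_plane_of_squareClasses S hS⟩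

/-- Examples: `ℚ(√2, √6)²` (classes `[2], [6]` generate `[3]`) and `ℚ(√10, √14)²` are NOT bipartite although no generator is
`≡ 3 (mod 4)` (`√3 = √2·√6/2`, `√35 = √10·√14/2`); `ℚ(√2, √10, √26)²` is. -/
theorem bipartite_examples :
    ¬ (planeUnitDistanceGraph.induce (fieldPoints (multiSqrtField {2, 6}))).Colorable 2 ∧
      ¬ (planeUnitDistanceGraph.induce (fieldPoints (multiSqrtField {10, 14}))).Colorable 2 ∧
      (planeUnitDistanceGraph.induce (fieldPoints (multiSqrtField {2, 10, 26}))).Colorable 2 :=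
  ⟨not_colorable_two_plane_of_not_pattern _ (by decide) (by decide),
    not_colorable_two_plane_of_not_pattern _ (by decide) (by decide),
    colorable_two_plane_of_squareClasses _ (by decide)⟩

end Summit.Ventures.DiscreteObjects.UnitDistance
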